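import Summits.SmoothPoincare4.SmoothPoincare4.Theses.EinsteinBulk
import Summits.SmoothPoincare4.SmoothPoincare4.Theorems.EinsteinBulkEinsteinHadamardFillingStandard

/-!
# Crux `EinsteinBulk.PEFillNearRound` (stmt-SmoothPoincare4-7997) — ROUTE-LEVEL SPLIT `standard-or-gap`
# (crux-strategist r1, RESTATED re-audit / BC2 redirect, 2026-08-17)

`PEFillNearRound ⇐ PEFillStandardSphere (item stmt-SmoothPoincare4-18033) ∧ YamabeNearRoundSpheresStandard (item stmt-SmoothPoincare4-18032)`.

* `X₁ = EinsteinBulk.PEFillStandardSphere` — PE-FILL(δ) on closed smooth 4-manifolds DIFFEOMORPHIC to `S⁴` (large-data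
  Poincaré–Einstein existence on `B⁵` for Yamabe-near-round classes; transversal to SPC4; the registered `stub_peFillStandard`
  of line standard-or-thin, verbatim).
* `X₂ = EinsteinBulk.YamabeNearRoundSpheresStandard` — Yamabe-near-round homotopy 4-spheres are diffeomorphic to `S⁴`
  (positive form of the uniform Yamabe GAP for exotica; the SPC4 half: `SPC4 ⇒ X₂`, `X₂ ∧ YamabeExtremalSpheres ⇒ SPC4`).

EXACTNESS. `PEFillNearRound → X₁` (restriction; `peFillStandardSphere_of_peFillNearRound` below) and
`PEFillNearRound ∧ LQS (7996) ∧ EinsteinHadamardFillingStandard (7999, PROVED) → X₂` (a PE-filled near-round class on `M` is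
pinched and recognised; `yamabeNearRoundSpheresStandard_of_peFillNearRound` below, sorry-free). So the split loses nothing.

This file is (i) the REGISTERED SKELETON of 7997 for this split — two stubs that ARE the route items BY NAME and the
kernel-checked composition `PEFillNearRound_of` — and (ii) the GLUE for a prover to land under `Theorems/`:
`peFillNearRoundOfPieces_proof : PEFillStandardSphere → YamabeNearRoundSpheresStandard → PEFillNearRound` (sorry-free,
axioms propext / Classical.choice / Quot.sound). The formal `route edit --split PEFillNearRound --into <18033> <18032>
--glue-by <landed decl>` bounced on the final-cycle rule only and is re-filed then (children attach by signature).
-/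

noncomputable section

set_option linter.dupNamespace false

open scoped Manifold ContDiff Topology ContinuousMap
open Summit.SmoothPoincare4.SmoothPoincare4.Theses

namespace Summit.SmoothPoincare4.SmoothPoincare4.Cruxes.PEFillNearRound.RouteSplit

/-! ## (ii) The glue, sorry-free, over the route's own decls -/

/-- Monotonicity of the inlined Yamabe lower bound in the slack parameter. -/
theorem yamabeBound_mono {δ δ' C V I : ℝ} (hδ : δ' ≤ δ) (hC : 0 ≤ C) (hV : 0 ≤ V)
    (h : (1 - δ') * C * V ≤ I) : (1 - δ) * C * V ≤ I :=
  (mul_le_mul_of_nonneg_right (mul_le_mul_of_nonneg_right (sub_le_sub_left hδ 1) hC) hV).trans h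

/-- **GLUE (BC2 redirect (b)): `PEFillStandardSphere → YamabeNearRoundSpheresStandard → PEFillNearRound`.**
Seam: `δ := min δ₁ δ₂`; for a homotopy 4-sphere `M` with a `δ`-near-round `g₀`, X₂ gives `M ≅ S⁴`, then X₁ fills `(M,[g₀])`.
`trivial_seam`: yes. This is the statement of the (future) glue item `PEFillNearRoundOfPieces`; a prover lands it verbatim. -/
theorem peFillNearRoundOfPieces_proof :
    EinsteinBulk.PEFillStandardSphere → EinsteinBulk.YamabeNearRoundSpheresStandard → EinsteinBulk.PEFillNearRound := by
  rintro ⟨δ₁, hδ₁, H1⟩ ⟨δ₂, hδ₂, H2⟩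
  refine ⟨min δ₁ δ₂, lt_min hδ₁ hδ₂, ?_⟩
  intro M _ _ _ _ _ _ _ _ _ he g₀ hY
  have hstd : Nonempty (M ≃ₘ⟮𝓡 4, 𝓡 4⟯ Metric.sphere (0 : EuclideanSpace ℝ (Fin 5)) 1) :=
    H2 M he g₀ (fun h' _ hconf =>
      yamabeBound_mono (min_le_right _ _) (by positivity) (Real.sqrt_nonneg _) (hY h' hconf))
  exact H1 M hstd g₀ (fun h' _ hconf =>
    yamabeBound_mono (min_le_left _ _) (by positivity) (Real.sqrt_nonneg _) (hY h' hconf))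

/-! ## Exactness bookkeeping (the split loses nothing) -/

/-- `PEFillNearRound → X₁`: a manifold diffeomorphic to `S⁴` is a homotopy 4-sphere through its diffeomorphism. -/
theorem peFillStandardSphere_of_peFillNearRound (h : EinsteinBulk.PEFillNearRound) :
    EinsteinBulk.PEFillStandardSphere := by
  obtain ⟨δ, hδ, H⟩ := h
  refine ⟨δ, hδ, ?_⟩
  intro M _ _ _ _ _ _ _ _ _ hstd g₀ hY
  obtain ⟨e⟩ := hstd
  exact H M e.toHomeomorph.toHomotopyEquiv g₀ hY

/-- `PEFillNearRound ∧ LQS ∧ EinsteinHadamardFillingStandard → X₂`: a PE-filled near-round class on a homotopy 4-sphere is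
pinched (`|K+1| ≤ 1/2`, Li–Qing–Shi, item 7996) hence non-positively curved, and the PROVED recogniser (item 7999) returns
`M ≅ S⁴`. (Same bookkeeping as the route's `closes`, minus Yamabe-extremality.) -/
theorem yamabeNearRoundSpheresStandard_of_peFillNearRound (hLQS : EinsteinBulk.YamabePinchedEinsteinBulk)
    (hRec : EinsteinBulk.EinsteinHadamardFillingStandard) (h : EinsteinBulk.PEFillNearRound) :
    EinsteinBulk.YamabeNearRoundSpheresStandard := by
  obtain ⟨δ₂, hδ₂, H2⟩ := hLQS (1 / 2) (by norm_num)
  obtain ⟨δ₃, hδ₃, H3⟩ := h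
  refine ⟨min δ₂ δ₃, lt_min hδ₂ hδ₃, ?_⟩
  intro M _ _ _ _ _ _ _ _ _ he g₀ hY
  obtain ⟨N, _, _, _, _, _, g, _, hRic, hpack⟩ := H3 M he g₀ (fun h' _ hconf =>
    yamabeBound_mono (min_le_right _ _) (by positivity) (Real.sqrt_nonneg _) (hY h' hconf))
  have hpinch := H2 M g₀ N g hRic hpack (fun h' _ hconf =>
    yamabeBound_mono (min_le_left _ _) (by positivity) (Real.sqrt_nonneg _) (hY h' hconf))
  have hK : ∀ (x : N) (X Y : TangentSpace (𝓡 5) x), g.inner x X X = 1 → g.inner x Y Y = 1 →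
      g.inner x X Y = 0 →
      (Literature.Geometry.Lorentzian.PseudoRiemannianMetric.ofRiemannian g).curvatureForm
        (Literature.Geometry.Lorentzian.PseudoRiemannianMetric.ofRiemannian g).leviCivita x X Y Y X ≤ 0 := by
    intro x X Y hX1 hY1 hXY0
    have h := abs_le.mp (hpinch x X Y hX1 hY1 hXY0)
    linarith [h.2]
  exact hRec M he g₀ N g hRic hpack hK

/-- The recogniser is PROVED in the tree, so exactness needs only the Li–Qing–Shi fact (item 7996). -/
theorem yamabeNearRoundSpheresStandard_of_peFillNearRound' (hLQS : EinsteinBulk.YamabePinchedEinsteinBulk)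
    (h : EinsteinBulk.PEFillNearRound) : EinsteinBulk.YamabeNearRoundSpheresStandard :=
  yamabeNearRoundSpheresStandard_of_peFillNearRound hLQS
    Summit.SmoothPoincare4.SmoothPoincare4.Theorems.EinsteinHadamardFillingStandard_proof h

/-! ## (i) The registered skeleton of 7997 for this split: the stubs ARE the two route items, by name -/

/-- **Stub 1 = item stmt-SmoothPoincare4-18033 `EinsteinBulk.PEFillStandardSphere`** (PE-FILL(δ) on `M ≅ S⁴`; plan: birth
skeleton `Lines/piece_X1_valley_continuity.lean` — continuity method: openness (Lee + LQS), closedness (CGJQ III, uniform),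
round class filled (ℍ⁵), VALLEY (near-maximal superlevel sets of `Y` on `Conf(S⁴)` reach the round class)). -/
theorem stub_peFillStandardSphere : EinsteinBulk.PEFillStandardSphere := by
  sorry

/-- **Stub 2 = item stmt-SmoothPoincare4-18032 `EinsteinBulk.YamabeNearRoundSpheresStandard`** (near-round homotopy 4-spheres
are standard; plan: birth skeleton `Lines/piece_X2_qc_smoothing.lean` — δ-near-round ⇒ (1+ε)-quasiconformal to round, and
(1+ε)-qc homotopy 4-spheres are smoothable to a diffeomorphism; alternative line: Yamabe ⇒ entropy comparison + sheet rung). -/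
theorem stub_yamabeNearRoundSpheresStandard : EinsteinBulk.YamabeNearRoundSpheresStandard := by
  sorry

/-- **THE SKELETON THEOREM: the crux BY NAME from the two stubs** (sorries only inside `stub_*`). -/
theorem PEFillNearRound_of : EinsteinBulk.PEFillNearRound :=
  peFillNearRoundOfPieces_proof stub_peFillStandardSphere stub_yamabeNearRoundSpheresStandard

end Summit.SmoothPoincare4.SmoothPoincare4.Cruxes.PEFillNearRound.RouteSplit

end
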